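import Literature.ComputerArithmetic.Shewchuk1997.Compress
import Literature.ComputerArithmetic.RumpZimmermannBoldoMelquiond2009.PredSucc
import Mathlib.Tactic.Linarith
import Mathlib.Tactic.Positivity
import Mathlib.Tactic.Ring
import Mathlib.Tactic.NormNum

/-!
# COMPRESS under ties-to-away: the RELATIVE-error reading of Shewchuk's p.333 conjecture fails for a
# FIXED IEEE tie rule (new work; a checked counterexample, p = 3)

New work of the certified-arithmetic venture (ENGINES group: shared numerical engines serving
client cells; rigour lives in the verifiers; every published number belongs to a client cell's
ledger, not to the engines group).  NEGATIVE knowledge for the line "sharp error of the largest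
component of COMPRESS" (`CompressSharpStair.lean`, `CompressCarryBound.lean`, `CompressTopError.lean`).

Shewchuk [Shewchuk1997, §2.7 p. 333], after Theorem 23 (`|h − hₙ| < ulp(hₙ)`): "the bound for
|h − hₙ| is not tight. (I conjecture that the largest possible relative error is exhibited by a number
that contains a nonzero bit every pth bit; note that 1 + ½ulp(1) + ¼[ulp(1)]² + ··· cannot be further
compressed.)"  With `ε = 2^-p` that family is `1 + ε + ε² + ⋯` with `hₙ = 1`; its relative errors
`(ε + ⋯ + ε^k)/(1 + ⋯ + ε^k)` increase to, and never reach, `ε`.  Read as a statement about the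
RELATIVE error `|h − hₙ|/|h|`, the conjecture therefore says `|h − hₙ| < ε·|h|` for every compressed `h`.

THIS FILE: that reading is FALSE for round-to-nearest with the IEEE 754-2008 attribute
roundTiesToAway (and for every other nearest rounding that sends the one midpoint met, `9216 =
4.5 · 2048`, upwards — ties-to-odd, ties-towards-+∞): in precision `p = 3` (quantum exponent `≥ 0`)
the nonoverlapping expansion `e = ⟨−7, −112, −1024, 10240⟩ = 9097` is a FIXED POINT of COMPRESS
(`compress_eq_self_of_tie_up`; the run meets exactly one tie, `10240 ⊕ (−1024) = fl(9216)`, and two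
inexact non-tie sums `fl(−1136) = −1024`, `fl(−119) = −112`, everything else exact), and its largest
component `10240` carries the relative error `1143/9097 = 0.12565… > 1/8 = ε`
(`compress_relative_error_tiesAway`), i.e. MORE than every member of the conjectured extremal family.
The mechanism: `hₙ = (2^(p−1) + 1)·u` sits just above a power of two, the carry below it is the
midpoint `−u/2` resolved AWAY from zero (upwards in magnitude) by the tie rule, and below that a
maximal same-sign tail `−(1−ε)·uε/2`, `−(1−ε)·uε²/4`; the same three rounding facts make the
analogous 4-component expansion a fixed point in every precision `p ≥ 2`, with relative error
`> ε` (`tiesAway_pattern_relative_error_gt`, the arithmetic for general `p`; the rounding facts are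
checked in Lean for `p = 3` only).

Consistency with the ULP form proved in this directory: `|9097 − 10240| = 1143 ≤ 1168 =
ulp(10240)/2 · (1 + ε + ε²)` (`tiesAway_witness_le_ulp_form`).  Companion file
`CompressRelativeErrorWitness.lean` gives a witness for an input-dependent tie rule and leaves the
fixed-rule case open; this file settles it negatively for ties-to-away / ties-to-odd.  STILL OPEN (not
claimed either way): the relative reading for round-to-nearest-EVEN and for ties-to-zero, where the
midpoint `9216` goes DOWN to `8192` (COMPRESS then returns `⟨1, 8, 896, 8192⟩`, relative error
`905/9097 < 1/8`) and exhaustive search of small formats found no violation.  HONEST FRAMING: Shewchuk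
states a conjecture about his arithmetic (IEEE double, round-to-even); nothing here refutes that
sentence for round-to-even — it shows the relative reading cannot be a theorem about round-to-nearest
"with any fixed tie-breaking rule", which is why the sharp bound of this directory is stated in ulps.
Non-vacuity: a nearest rounding with `fl 9216 = 10240` exists (`exists_isRoundNearest_tie_up`).
-/

namespace Summit.Ventures.CertifiedArithmetic.Expansions

open Literature.ComputerArithmetic.JeannerodRump2018
open Literature.ComputerArithmetic.BoldoJeannerodMelquiondMuller2023 hiding twoSum twoSum_fst
open Literature.ComputerArithmetic.RumpOgitaOishi2008 (IsSucc)
open Literature.ComputerArithmetic.RumpZimmermannBoldoMelquiond2009 (IsTiesAway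
  fl_midpoint_of_tiesAway_nonneg)
open Literature.ComputerArithmetic.Shewchuk1997

variable {p : ℕ} {emin : ℤ} {fl : ℚ → ℚ}

/-! ### Generic helpers: a nearest rounding at a non-tie point is determined by `RD` and `RU` -/

/-- If `RU(t)` is strictly nearer to `t` than `RD(t)`, every round-to-nearest map returns `RU(t)`.
[cite: BoldoEtAl2023, §2.2 ("RN(t) is the element of F nearest to t"; RD, RU)] -/
private theorem fl_eq_of_nearer_up (hfl : IsRoundNearest p emin fl) {t a b : ℚ}
    (ha : IsRD p emin t a) (hb : IsRU p emin t b) (h : |t - b| < |t - a|) : fl t = b := by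
  have hF := (hfl t).1
  have hnb := (hfl t).2 b hb.1
  have hat : a ≤ t := ha.2.1
  have htb : t ≤ b := hb.2.1
  rcases le_or_gt (fl t) t with hle | hgt
  · exfalso
    have h1 : fl t ≤ a := ha.2.2 _ hF hle
    rw [abs_of_nonneg (by linarith : 0 ≤ t - fl t)] at hnb
    rw [abs_of_nonpos (by linarith : t - b ≤ 0)] at h hnb
    rw [abs_of_nonneg (by linarith : 0 ≤ t - a)] at h
    linarith
  · have h1 : b ≤ fl t := hb.2.2 _ hF hgt.le
    rw [abs_of_nonpos (by linarith : t - fl t ≤ 0), abs_of_nonpos (by linarith : t - b ≤ 0)] at hnb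
    linarith

/-- If `RD(t)` is strictly nearer to `t` than `RU(t)`, every round-to-nearest map returns `RD(t)`.
[cite: BoldoEtAl2023, §2.2 ("RN(t) is the element of F nearest to t"; RD, RU)] -/
private theorem fl_eq_of_nearer_down (hfl : IsRoundNearest p emin fl) {t a b : ℚ}
    (ha : IsRD p emin t a) (hb : IsRU p emin t b) (h : |t - a| < |t - b|) : fl t = a := by
  have hF := (hfl t).1
  have hna := (hfl t).2 a ha.1
  have hat : a ≤ t := ha.2.1
  have htb : t ≤ b := hb.2.1
  rcases le_or_gt (fl t) t with hle | hgt
  · have h1 : fl t ≤ a := ha.2.2 _ hF hle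
    rw [abs_of_nonneg (by linarith : 0 ≤ t - fl t), abs_of_nonneg (by linarith : 0 ≤ t - a)] at hna
    linarith
  · exfalso
    have h1 : b ≤ fl t := hb.2.2 _ hF hgt.le
    rw [abs_of_nonpos (by linarith : t - fl t ≤ 0)] at hna
    rw [abs_of_nonneg (by linarith : 0 ≤ t - a)] at h hna
    rw [abs_of_nonpos (by linarith : t - b ≤ 0)] at h
    linarith

/-- The ulp of `t` is `2^e` when `|t|` is sandwiched between two NORMAL floats `M₁·2^e`, `M₂·2^e` of
that exponent. [cite: BoldoEtAl2023, §2.1 Def. 2.1 / Def. 2.4 (ulp of a canonical float), ulp monotone] -/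
private theorem ulp_eq_of_sandwich (hp : 1 ≤ p) {M₁ M₂ e : ℤ} (h₁ : |M₁| < 2 ^ p)
    (h₁' : 2 ^ (p - 1) ≤ |M₁|) (h₂ : |M₂| < 2 ^ p) (h₂' : 2 ^ (p - 1) ≤ |M₂|) (he : emin ≤ e)
    (hM₁ : M₁ ≠ 0) (hM₂ : M₂ ≠ 0) {t : ℚ} (hlo : |(M₁ : ℚ) * 2 ^ e| ≤ |t|)
    (hhi : |t| ≤ |(M₂ : ℚ) * 2 ^ e|) : ulp p emin t = 2 ^ e := by
  have hu₁ := ulp_int_mul_two_zpow (p := p) (emin := emin) hp h₁ he hM₁ (Or.inl h₁')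
  have hu₂ := ulp_int_mul_two_zpow (p := p) (emin := emin) hp h₂ he hM₂ (Or.inl h₂')
  have := ulp_mono (p := p) (emin := emin) hlo
  have := ulp_mono (p := p) (emin := emin) hhi
  linarith

/-- `RD(t) = n·u` and `RU(t) = m·u` from the three numerical facts `ulp(t) = u`, `⌊t/u⌋ = n`,
`⌈t/u⌉ = m`. [cite: BoldoEtAl2023, §2.2 (RD(t) = ⌊t/ulp t⌋·ulp t, RU(t) = ⌈t/ulp t⌉·ulp t)] -/
private theorem isRD_isRU (hp : 1 ≤ p) {t u : ℚ} {n m : ℤ} (hu : ulp p emin t = u)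
    (hn : ⌊t / u⌋ = n) (hm : ⌈t / u⌉ = m) :
    IsRD p emin t ((n : ℚ) * u) ∧ IsRU p emin t ((m : ℚ) * u) := by
  have h1 := isRD_floor_mul_ulp (p := p) (emin := emin) hp t
  have h2 := isRU_ceil_mul_ulp (p := p) (emin := emin) hp t
  rw [hu, hn] at h1
  rw [hu, hm] at h2
  exact ⟨h1, h2⟩

/-! ### The format `F(3, 0)` around the three inexact sums of the run -/

/-- `RD(9216) = 8192`, `RU(9216) = 10240` (`9216 = 4.5 · 2048` is the midpoint; `ulp = 2048` on
`[8192, 14336]`). [cite: BoldoEtAl2023, §2.1–2.2] -/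
private theorem rd_ru_9216 : IsRD 3 0 (9216 : ℚ) 8192 ∧ IsRU 3 0 (9216 : ℚ) 10240 := by
  have hu : ulp 3 0 (9216 : ℚ) = 2048 := by
    have := ulp_eq_of_sandwich (p := 3) (emin := 0) (by norm_num) (M₁ := 4) (M₂ := 7) (e := 11)
      (by norm_num) (by norm_num) (by norm_num) (by norm_num) (by norm_num) (by norm_num) (by norm_num)
      (t := 9216) (by norm_num) (by norm_num)
    norm_num at this; exact this
  have h := isRD_isRU (p := 3) (emin := 0) (by norm_num) hu
    (show ⌊(9216 : ℚ) / 2048⌋ = 4 by rw [Int.floor_eq_iff]; norm_num)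
    (show ⌈(9216 : ℚ) / 2048⌉ = 5 by rw [Int.ceil_eq_iff]; norm_num)
  norm_num at h; exact h

/-- `RD(−1136) = −1280`, `RU(−1136) = −1024` (`ulp = 256` on `[1024, 1792]`; `−1136` is `112` below
`−1024` and `144` above `−1280`: NOT a tie). [cite: BoldoEtAl2023, §2.1–2.2] -/
private theorem rd_ru_1136 : IsRD 3 0 (-1136 : ℚ) (-1280) ∧ IsRU 3 0 (-1136 : ℚ) (-1024) := by
  have hu : ulp 3 0 (-1136 : ℚ) = 256 := by
    have := ulp_eq_of_sandwich (p := 3) (emin := 0) (by norm_num) (M₁ := 4) (M₂ := 7) (e := 8)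
      (by norm_num) (by norm_num) (by norm_num) (by norm_num) (by norm_num) (by norm_num) (by norm_num)
      (t := -1136) (by norm_num) (by norm_num)
    norm_num at this; exact this
  have h := isRD_isRU (p := 3) (emin := 0) (by norm_num) hu
    (show ⌊(-1136 : ℚ) / 256⌋ = -5 by rw [Int.floor_eq_iff]; norm_num)
    (show ⌈(-1136 : ℚ) / 256⌉ = -4 by rw [Int.ceil_eq_iff]; norm_num)
  norm_num at h; exact h

/-- `RD(−119) = −128`, `RU(−119) = −112`.  Here `ulp(−119) = 16`: it is a power of two,
`≥ ulp(112) = 16` by monotonicity and `≤ 119/4 < 32` in the normal range; `−119` is `7` below `−112`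
and `9` above `−128`: NOT a tie. [cite: BoldoEtAl2023, §2.1 (ulp(t) ≤ |t|/2^(p−1), t normal; ulp is a
power of 2; ulp monotone), §2.2 (RD, RU)] -/
private theorem rd_ru_119 : IsRD 3 0 (-119 : ℚ) (-128) ∧ IsRU 3 0 (-119 : ℚ) (-112) := by
  have hu : ulp 3 0 (-119 : ℚ) = 16 := by
    have h112 : ulp 3 0 (((7 : ℤ) : ℚ) * 2 ^ (4 : ℤ)) = 2 ^ (4 : ℤ) :=
      ulp_int_mul_two_zpow (p := 3) (emin := 0) (by norm_num) (by norm_num) (by norm_num) (by norm_num)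
        (Or.inl (by norm_num))
    norm_num at h112
    have hlo := ulp_mono (p := 3) (emin := 0) (show |(112 : ℚ)| ≤ |(-119 : ℚ)| by norm_num)
    have hhi := ulp_le_of_normal (p := 3) (emin := 0) (by norm_num) (t := -119)
      (by rw [abs_of_neg (by norm_num)]; norm_num)
    obtain ⟨k, -, hk⟩ := exists_ulp_eq_two_zpow (p := 3) (emin := 0) (-119 : ℚ)
    rw [hk] at hlo hhi ⊢
    rw [h112] at hlo
    norm_num at hhi
    -- `16 ≤ 2^k ≤ 29.75` forces `k = 4`
    have hk4 : k = 4 := by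
      rcases lt_trichotomy k 4 with hlt | heq | hgt
      · exfalso
        have : (2 : ℚ) ^ k ≤ 2 ^ (3 : ℤ) := zpow_le_zpow_right₀ (by norm_num) (by omega)
        norm_num at this; linarith
      · exact heq
      · exfalso
        have : (2 : ℚ) ^ (5 : ℤ) ≤ 2 ^ k := zpow_le_zpow_right₀ (by norm_num) (by omega)
        norm_num at this; linarith
    rw [hk4]; norm_num
  have h := isRD_isRU (p := 3) (emin := 0) (by norm_num) hu
    (show ⌊(-119 : ℚ) / 16⌋ = -8 by rw [Int.floor_eq_iff]; norm_num)
    (show ⌈(-119 : ℚ) / 16⌉ = -7 by rw [Int.ceil_eq_iff]; norm_num)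
  norm_num at h; exact h

/-- `succ(8192) = 10240` in `F(3, 0)` (no 3-bit float strictly between: a float `≤ 9216` is
`≤ RD(9216) = 8192`, a float `≥ 9216` is `≥ RU(9216) = 10240`). [cite: RumpOgitaOishi2008, §2 (succ)] -/
private theorem isSucc_8192_10240 : IsSucc 3 0 (8192 : ℚ) 10240 := by
  refine ⟨⟨5, 11, by norm_num, by norm_num, by norm_num⟩, by norm_num, fun h hh hlt => ?_⟩
  rcases le_or_gt h 9216 with hle | hgt
  · have := rd_ru_9216.1.le_of_isFloat_le hh hle
    linarith
  · exact rd_ru_9216.2.le_of_isFloat_ge hh hgt.le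

/-! ### Replaying COMPRESS -/

/-- The run of COMPRESS on `⟨−7, −112, −1024, 10240⟩` under ANY `fl` with the seven listed values
(FAST-TWO-SUM modelled with its three roundings): first traversal `10240 ⊕ (−1024) = fl 9216 = 10240`,
roundoff `−1024` (emit `10240`); `−1024 ⊕ (−112) = fl(−1136) = −1024`, roundoff `−112` (emit `−1024`);
`−112 ⊕ (−7) = fl(−119) = −112`, roundoff `−7` (emit `−112`), bottom `−7`; the second traversal meets
the same three sums and emits `−7, −112, −1024`, top `10240`: the input is returned UNCHANGED.
[cite: Shewchuk1997, §2.7 p. 332 (COMPRESS)] -/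
private theorem compress_eval {fl : ℚ → ℚ} (h0 : fl 0 = 0) (h7 : fl (-7) = -7)
    (h112 : fl (-112) = -112) (h1024 : fl (-1024) = -1024) (h119 : fl (-119) = -112)
    (h1136 : fl (-1136) = -1024) (h9216 : fl 9216 = 10240) :
    compress fl [-7, -112, -1024, 10240] = [-7, -112, -1024, 10240] := by
  norm_num [compress, compressDown, compressUp, fastTwoSum, h0, h7, h112, h1024, h119, h1136, h9216]

/-- **Fixed point.** For EVERY round-to-nearest map on `F(3, 0)` that resolves the midpoint
`9216 = 4.5·2048` upwards (`fl 9216 = 10240`: ties-to-away, ties-to-odd, ties-towards-+∞ all do),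
COMPRESS returns `⟨−7, −112, −1024, 10240⟩` unchanged: the two other inexact sums of the run are not
ties and are forced (`fl(−1136) = −1024`, `fl(−119) = −112`), the rest is exact.
[cite: Shewchuk1997, §2.7 p. 332 (COMPRESS); BoldoEtAl2023, §2.2] -/
theorem compress_eq_self_of_tie_up (hfl : IsRoundNearest 3 0 fl) (htie : fl 9216 = 10240) :
    compress fl [-7, -112, -1024, 10240] = [-7, -112, -1024, 10240] :=
  compress_eval
    (fl_eq_self hfl ⟨0, 0, by norm_num, le_rfl, by norm_num⟩)
    (fl_eq_self hfl ⟨-7, 0, by norm_num, le_rfl, by norm_num⟩)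
    (fl_eq_self hfl ⟨-7, 4, by norm_num, by norm_num, by norm_num⟩)
    (fl_eq_self hfl ⟨-1, 10, by norm_num, by norm_num, by norm_num⟩)
    (fl_eq_of_nearer_up hfl rd_ru_119.1 rd_ru_119.2 (by norm_num))
    (fl_eq_of_nearer_up hfl rd_ru_1136.1 rd_ru_1136.2 (by norm_num))
    htie

/-- The input `⟨−7, −112, −1024, 10240⟩` consists of floats of `F(3, 0)` (`−7·2⁰, −7·2⁴, −1·2¹⁰,
5·2¹¹`). [cite: Shewchuk1997, §2.1 p. 309] -/
theorem tiesAway_witness_isFloat : ∀ x ∈ ([-7, -112, -1024, 10240] : List ℚ), IsFloat 3 0 x := by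
  intro x hx
  simp only [List.mem_cons, List.mem_nil_iff, or_false] at hx
  rcases hx with rfl | rfl | rfl | rfl
  · exact ⟨-7, 0, by norm_num, le_rfl, by norm_num⟩
  · exact ⟨-7, 4, by norm_num, by norm_num, by norm_num⟩
  · exact ⟨-1, 10, by norm_num, by norm_num, by norm_num⟩
  · exact ⟨5, 11, by norm_num, by norm_num, by norm_num⟩

/-- The input `⟨−7, −112, −1024, 10240⟩` is a nonoverlapping expansion, smallest first
(`IsExpansion 1`: `|−7| < 2⁴ ∣ 112`, `|·| < 2¹⁰ ∣ 1024`, `|·| < 2¹¹ ∣ 10240`).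
[cite: Shewchuk1997, §2.1 p. 309 (nonoverlapping); Theorem 23 (hypotheses)] -/
theorem tiesAway_witness_isExpansion : IsExpansion 1 ([-7, -112, -1024, 10240] : List ℚ) := by
  have b112 : ∀ x : ℚ, |x| < 16 → Below 1 x (-112) :=
    fun x hx => ⟨4, ⟨-7, by norm_num⟩, by norm_num; exact hx⟩
  have b1024 : ∀ x : ℚ, |x| < 1024 → Below 1 x (-1024) :=
    fun x hx => ⟨10, ⟨-1, by norm_num⟩, by norm_num; exact hx⟩
  have b10240 : ∀ x : ℚ, |x| < 2048 → Below 1 x 10240 :=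
    fun x hx => ⟨11, ⟨5, by norm_num⟩, by norm_num; exact hx⟩
  refine List.Pairwise.cons ?_ (List.Pairwise.cons ?_ (List.Pairwise.cons ?_
    (List.pairwise_singleton _ _)))
  · intro y hy
    simp only [List.mem_cons, List.mem_nil_iff, or_false] at hy
    rcases hy with rfl | rfl | rfl
    · exact b112 _ (by norm_num)
    · exact b1024 _ (by norm_num)
    · exact b10240 _ (by norm_num)
  · intro y hy
    simp only [List.mem_cons, List.mem_nil_iff, or_false] at hy
    rcases hy with rfl | rfl
    · exact b1024 _ (by norm_num)
    · exact b10240 _ (by norm_num)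
  · intro y hy
    simp only [List.mem_cons, List.mem_nil_iff, or_false] at hy
    subst hy
    exact b10240 _ (by norm_num)

/-! ### The counterexample -/

/-- **The relative reading of the p.333 conjecture fails under IEEE roundTiesToAway (p = 3).**  For
every round-to-nearest map `fl` on `F(3, 0)` with the ties-to-away attribute (`IsTiesAway`: at a
midpoint the candidate of larger magnitude wins), COMPRESS fixes the nonoverlapping expansion
`e = ⟨−7, −112, −1024, 10240⟩ = 9097`, and the largest component `10240` has RELATIVE error
`|9097 − 10240|/9097 = 1143/9097 > 1/8 = 2^-p` — more than every member `1 + ε + ⋯ + ε^k` of the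
conjectured extremal family (relative error `< ε`).
[cite: Shewchuk1997, §2.7 p. 333 (conjecture after Theorem 23); RumpZimmermannBoldoMelquiond2009,
§2.2 ("'ties to away' as defined by IEEE 754-2008"); BoldoEtAl2023, §2.2 (RN_a)] -/
theorem compress_relative_error_tiesAway (hfl : IsRoundNearest 3 0 fl) (haway : IsTiesAway 3 0 fl) :
    compress fl [-7, -112, -1024, 10240] = [-7, -112, -1024, 10240] ∧
      ((2 : ℚ) ^ 3)⁻¹ <
        |([-7, -112, -1024, 10240] : List ℚ).sum - 10240| / |([-7, -112, -1024, 10240] : List ℚ).sum| := by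
  have htie : fl 9216 = 10240 := by
    have := fl_midpoint_of_tiesAway_nonneg hfl haway ⟨4, 11, by norm_num, by norm_num, by norm_num⟩
      isSucc_8192_10240 (by norm_num)
    norm_num at this
    exact this
  exact ⟨compress_eq_self_of_tie_up hfl htie, by norm_num⟩

/-- The same conclusion for every nearest rounding sending the midpoint `9216` upwards (ties-to-odd:
`10240 = 5·2¹¹` has the odd significand; ties-towards-+∞), as a standalone statement.
[cite: Shewchuk1997, §2.7 p. 333; BoldoEtAl2023, §2.2] -/
theorem compress_relative_error_of_tie_up (hfl : IsRoundNearest 3 0 fl) (htie : fl 9216 = 10240) :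
    compress fl [-7, -112, -1024, 10240] = [-7, -112, -1024, 10240] ∧
      ((2 : ℚ) ^ 3)⁻¹ <
        |([-7, -112, -1024, 10240] : List ℚ).sum - 10240| / |([-7, -112, -1024, 10240] : List ℚ).sum| :=
  ⟨compress_eq_self_of_tie_up hfl htie, by norm_num⟩

/-- Non-vacuity of the hypothesis class: there IS a round-to-nearest map on `F(3, 0)` with
`fl 9216 = 10240` — e.g. round-to-nearest-even with that single midpoint re-broken upwards (every float
is at distance `≥ 1024 = |9216 − 10240|` from `9216`). [cite: BoldoEtAl2023, §2.2 (RN_e; tie rules)] -/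
theorem exists_isRoundNearest_tie_up : ∃ fl : ℚ → ℚ, IsRoundNearest 3 0 fl ∧ fl 9216 = 10240 := by
  obtain ⟨fl, hfl⟩ : ∃ fl : ℚ → ℚ, fl = fun t => if t = 9216 then (10240 : ℚ) else roundTiesEven 3 0 t :=
    ⟨_, rfl⟩
  have h1 : fl 9216 = 10240 := by rw [hfl]; norm_num
  refine ⟨fl, fun t => ?_, h1⟩
  by_cases ht : t = 9216
  · subst ht
    rw [h1]
    refine ⟨⟨5, 11, by norm_num, by norm_num, by norm_num⟩, fun f hf => ?_⟩
    rw [show |(9216 : ℚ) - 10240| = 1024 by norm_num]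
    rcases le_or_gt f 9216 with hle | hgt
    · have := rd_ru_9216.1.le_of_isFloat_le hf hle
      rw [abs_of_nonneg (by linarith)]; linarith
    · have := rd_ru_9216.2.le_of_isFloat_ge hf hgt.le
      rw [abs_of_nonpos (by linarith)]; linarith
  · rw [show fl t = roundTiesEven 3 0 t by rw [hfl]; simp [ht]]
    exact isRoundNearest_roundTiesEven (p := 3) (emin := 0) (by norm_num) t

/-- Consistency with the ULP form (`CompressTopError.lean`: with `k` lower components,
`|Σe − hₙ| ≤ ulp(hₙ)/2 · (1 + ε + ⋯ + ε^(k−1))`): here `k = 3`, `ulp(10240) = 2048`, and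
`1143 ≤ 1024 · (1 + ⅛ + ¹⁄₆₄) = 1168`. [cite: Shewchuk1997, §2.7 p. 333; BoldoEtAl2023, §2.1 (ulp)] -/
theorem tiesAway_witness_le_ulp_form :
    |([-7, -112, -1024, 10240] : List ℚ).sum - 10240| ≤
      ulp 3 0 10240 / 2 * (1 + ((2 : ℚ) ^ 3)⁻¹ + (((2 : ℚ) ^ 3)⁻¹) ^ 2) := by
  have hu : ulp 3 0 (10240 : ℚ) = 2048 := by
    have := ulp_int_mul_two_zpow (p := 3) (emin := 0) (M := 5) (e := 11) (by norm_num) (by norm_num)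
      (by norm_num) (by norm_num) (Or.inl (by norm_num))
    norm_num at this; exact this
  rw [hu]; norm_num

/-- **The pattern in every precision.**  With `ε = 2^-p`, `u > 0` the ulp of the top component
`hₙ = (2^(p−1) + 1)·u = (1 + 2ε)·u/(2ε)`, and the three lower components `−u/2` (the midpoint below
`hₙ`, kept by ties-to-away), `−(1−ε)·uε/2`, `−(1−ε)·uε²/4` (the largest floats that still round back
into their carries), the relative error `err/(hₙ − err)`, `err = u/2·(1 + ε(1−ε) + ε²(1−ε)/2)`, EXCEEDS
`ε` for every `p ≥ 2` (for `p = 3`, `u = 2048` this is `1143/9097`).  Pure arithmetic; that this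
configuration is a COMPRESS fixed point under ties-to-away is checked above for `p = 3` only.
[cite: Shewchuk1997, §2.7 p. 333 (conjecture)] -/
theorem tiesAway_pattern_relative_error_gt (hp : 2 ≤ p) {u : ℚ} (hu : 0 < u) :
    ((2 : ℚ) ^ p)⁻¹ <
      (u / 2 * (1 + ((2 : ℚ) ^ p)⁻¹ * (1 - ((2 : ℚ) ^ p)⁻¹) +
          (((2 : ℚ) ^ p)⁻¹) ^ 2 * (1 - ((2 : ℚ) ^ p)⁻¹) / 2)) /
        ((1 + 2 * ((2 : ℚ) ^ p)⁻¹) * u / (2 * ((2 : ℚ) ^ p)⁻¹) -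
          u / 2 * (1 + ((2 : ℚ) ^ p)⁻¹ * (1 - ((2 : ℚ) ^ p)⁻¹) +
            (((2 : ℚ) ^ p)⁻¹) ^ 2 * (1 - ((2 : ℚ) ^ p)⁻¹) / 2)) := by
  set ε : ℚ := ((2 : ℚ) ^ p)⁻¹ with hε
  have hεpos : 0 < ε := by positivity
  have hεne : ε ≠ 0 := hεpos.ne'
  have hεle : ε ≤ 1 / 4 := by
    have h4 : (2 : ℚ) ^ 2 ≤ 2 ^ p := pow_le_pow_right₀ (by norm_num) hp
    rw [hε, inv_le_comm₀ (by positivity) (by norm_num)]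
    norm_num at h4 ⊢
    exact h4
  -- abbreviations: err = u/2 · A,  hₙ = (1 + 2ε)·u/(2ε)
  set A : ℚ := 1 + ε * (1 - ε) + ε ^ 2 * (1 - ε) / 2 with hA
  have h1ε : 0 ≤ 1 - ε := by linarith
  have hA2 : A < 2 := by
    rw [hA]
    nlinarith [mul_le_of_le_one_right hεpos.le (by linarith : 1 - ε ≤ 1),
      mul_le_of_le_one_right (sq_nonneg ε) (by linarith : 1 - ε ≤ 1),
      mul_le_mul_of_nonneg_left hεle hεpos.le]
  have hden : 0 < (1 + 2 * ε) * u / (2 * ε) - u / 2 * A := by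
    have h2 : (2 : ℚ) ≤ (1 + 2 * ε) / (2 * ε) := by
      rw [le_div_iff₀ (by positivity)]
      linarith
    have h3 : (1 + 2 * ε) * u / (2 * ε) = (1 + 2 * ε) / (2 * ε) * u := by ring
    rw [h3]
    have h4 : 2 * u ≤ (1 + 2 * ε) / (2 * ε) * u := mul_le_mul_of_nonneg_right h2 hu.le
    have h5 : u / 2 * A < u / 2 * 2 := mul_lt_mul_of_pos_left hA2 (by positivity)
    linarith
  rw [lt_div_iff₀ hden]
  -- goal: ε · (hₙ − err) < err, i.e. u(1 + 2ε)/2 < (u/2)·A·(1 + ε); and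
  -- A(1+ε) − (1+2ε) = ε²/2 · (1 − 2ε − ε²) > 0 because ε ≤ 1/4 < √2 − 1.
  have hkey : 1 + 2 * ε < A * (1 + ε) := by
    have h6 : A * (1 + ε) - (1 + 2 * ε) = ε ^ 2 / 2 * (1 - 2 * ε - ε ^ 2) := by rw [hA]; ring
    have h7 : 0 < ε ^ 2 / 2 * (1 - 2 * ε - ε ^ 2) :=
      mul_pos (by positivity) (by nlinarith)
    linarith
  have h3 : ε * ((1 + 2 * ε) * u / (2 * ε) - u / 2 * A) =
      u / 2 * (1 + 2 * ε) - ε * (u / 2 * A) := by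
    field_simp
  rw [h3]
  have h4 : u / 2 * (1 + 2 * ε) < u / 2 * (A * (1 + ε)) := mul_lt_mul_of_pos_left hkey (by positivity)
  have h5 : u / 2 * (A * (1 + ε)) = u / 2 * A + ε * (u / 2 * A) := by ring
  rw [h5] at h4
  linarith

end Summit.Ventures.CertifiedArithmetic.Expansions
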